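import Mathlib
import Summits.QuantumFields.YangMills.Theses.TransverseWardBL

/-!
# TransverseWardBL — glue of the split of `LargeFieldInsensitivity`

`LargeFieldInsensitivityOfSplit : DefectTail → ResponseFromTail → LargeFieldInsensitivity` (route
`route-QuantumFields-TransverseWardBL`, split rev 1, D-0145 LINE g9-B, seat ym-idea-4 g9): instantiate the `∀ κ` of
`ResponseFromTail` at the `κ` supplied by `DefectTail`. Pure logic; no summit, no rung and no crux is proved here.
-/

namespace Summit.QuantumFields.YangMills.Theorems

open Summit.QuantumFields.YangMills.Theses.TransverseWardBL in
/-- The glue item of the split of `LargeFieldInsensitivity` holds (modus ponens at the tail rate `κ`). [folklore] -/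
theorem transverseWardBL_largeFieldInsensitivityOfSplit :
    Summit.QuantumFields.YangMills.Theses.TransverseWardBL.LargeFieldInsensitivityOfSplit := by
  intro h1 h2
  obtain ⟨κ, hκ, hT⟩ := h1
  exact h2 κ hκ hT

end Summit.QuantumFields.YangMills.Theorems
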